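import Summits.Ventures.PercRepro.S3MaxFlatKit

/-!
# PercRepro — THE MAXIMAL-FLAT KIT, THE COUNTING ROWS (p7 g22, S3 feeder): the glued sets, the `U`-row and the `Y`-rows of a
level-`q` cell with a rank-`q` set `F` of `n − (p − q + 1)` points

On S3MaxFlatKit (rank additivity `ρ(S ∪ T) = ρ(S) + |T|` for `S ⊆ F`, `T ⊊ X = E ∖ F`): the glued sets `S ∪ T` with
`S ∈ fSets F (k − j) (r − j)`, `T ⊆ X`, `|T| = j` are `C(p − q + 1, j)·#fSets F (k − j) (r − j)` distinct `k`-sets of rank `r`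
(`ncard_glue`, `glue_subset_rkSets`; no new definition — the glued family is written as an image), disjoint for distinct `j` (`glue_disjoint`); a `U`-set meets `X` in at most one point
(`ncard_uSets_le_fSets`); the `Y`-rows `three_glue_le_rkSets` / `two_glue_le_rkSets`.
Axioms: standard.
-/

open scoped Matroid

namespace PercRepro

namespace S3MF

open Set Finset S2LP S3LP

variable {α : Type} {M : Matroid α} [M.Finite]

omit [M.Finite] in
/-- The trace of a glued set on `F` is its `F`-part. -/
theorem union_inter_left {F S T : Set α} (hS : S ⊆ F) (hT : T ⊆ M.E \ F) : (S ∪ T) ∩ F = S := by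
  ext z
  simp only [Set.mem_inter_iff, Set.mem_union]
  constructor
  · rintro ⟨hz | hz, hzF⟩
    · exact hz
    · exact absurd hzF (hT hz).2
  · intro hz; exact ⟨Or.inl hz, hS hz⟩

omit [M.Finite] in
/-- The trace of a glued set on `E ∖ F` is its `T`-part. -/
theorem union_inter_right {F S T : Set α} (hS : S ⊆ F) (hT : T ⊆ M.E \ F) : (S ∪ T) ∩ (M.E \ F) = T := by
  ext z
  simp only [Set.mem_inter_iff, Set.mem_union]
  constructor
  · rintro ⟨hz | hz, hzX⟩
    · exact absurd (hS hz) hzX.2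
    · exact hz
  · intro hz; exact ⟨Or.inr hz, hT hz⟩

omit [M.Finite] in
/-- Glued sets of different `T`-sizes are distinct. -/
theorem glue_disjoint {F : Set α} (k r : ℕ) {j j' : ℕ} (hjj' : j ≠ j') :
    Disjoint ((fun P : Set α × Set α => P.1 ∪ P.2) '' (S1.rkSets (M ↾ F) (k - j) (r - j) ×ˢ {T : Set α | T ⊆ M.E \ F ∧ T.ncard = j}))
      ((fun P : Set α × Set α => P.1 ∪ P.2) '' (S1.rkSets (M ↾ F) (k - j') (r - j') ×ˢ {T : Set α | T ⊆ M.E \ F ∧ T.ncard = j'})) := by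
  rw [Set.disjoint_left]
  rintro A ⟨⟨S, T⟩, ⟨hS, hT⟩, rfl⟩ ⟨⟨S', T'⟩, ⟨hS', hT'⟩, h⟩
  simp only [Set.mem_setOf_eq] at h hS hT hS' hT'
  apply hjj'
  have e1 := union_inter_right (M := M) (mem_rkSets_restrict.1 hS).1 hT.1
  have e2 := union_inter_right (M := M) (mem_rkSets_restrict.1 hS').1 hT'.1
  rw [h] at e2
  have e : T = T' := e1.symm.trans e2
  rw [← hT.2, ← hT'.2, e]

section MaxFlat

variable {p q : ℕ} (hM : M.eRank = (p : ℕ∞)) (hcol : M.coloops = ∅) {F : Set α} (hF : F ⊆ M.E)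
  (hFr : M.eRk F = (q : ℕ∞)) (hqp : q < p) (hFn : F.ncard + (p - q + 1) = M.E.ncard)
include hM hcol hF hFr hqp hFn

/-- The glued sets are `k`-sets of rank `r`. -/
theorem glue_subset_rkSets (k r j : ℕ) (hjk : j ≤ k) (hjr : j ≤ r) (hjc : j < p - q + 1) :
    (fun P : Set α × Set α => P.1 ∪ P.2) '' (S1.rkSets (M ↾ F) (k - j) (r - j) ×ˢ {T : Set α | T ⊆ M.E \ F ∧ T.ncard = j})
      ⊆ S1.rkSets M k r := by
  rintro A ⟨⟨S, T⟩, ⟨hS, hT⟩, rfl⟩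
  obtain ⟨hSF, hSk, hSr⟩ := mem_rkSets_restrict.1 hS
  obtain ⟨hTX, hTj⟩ := hT
  have hXfin : (M.E \ F).Finite := M.ground_finite.subset sdiff_subset
  have hTne : T ≠ M.E \ F := by
    intro h; rw [h, ncard_compl_eq hF hFn] at hTj; omega
  have hdisj : Disjoint S T := Set.disjoint_left.2 (fun x hxS hxT => (hTX hxT).2 (hSF hxS))
  refine ⟨union_subset (hSF.trans hF) (hTX.trans sdiff_subset), ?_, ?_⟩
  · simp only
    rw [ncard_union_eq hdisj ((M.ground_finite.subset hF).subset hSF) (hXfin.subset hTX), hSk, hTj]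
    omega
  · simp only
    rw [eRk_union_eq_add hM hcol hF hFr hqp hFn hSF hTX hTne hSr, hTj]
    congr 1
    omega

omit hM hcol hFr hqp in
/-- **The number of glued sets**: `#glue k r j = #fSets F (k − j) (r − j) · C(p − q + 1, j)`. -/
theorem ncard_glue (k r j : ℕ) :
    ((fun P : Set α × Set α => P.1 ∪ P.2) '' (S1.rkSets (M ↾ F) (k - j) (r - j) ×ˢ {T : Set α | T ⊆ M.E \ F ∧ T.ncard = j})).ncard =
      (S1.rkSets (M ↾ F) (k - j) (r - j)).ncard * Nat.choose (p - q + 1) j := by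
  have hXfin : (M.E \ F).Finite := M.ground_finite.subset sdiff_subset
  rw [InjOn.ncard_image, ncard_prod, S1.ncard_setOf_subset_ncard_eq hXfin j, ncard_compl_eq hF hFn]
  rintro ⟨S, T⟩ ⟨hS, hT⟩ ⟨S', T'⟩ ⟨hS', hT'⟩ h
  simp only [Set.mem_setOf_eq] at h hS hT hS' hT'
  have e1 := union_inter_left (M := M) (mem_rkSets_restrict.1 hS).1 hT.1
  have e2 := union_inter_left (M := M) (mem_rkSets_restrict.1 hS').1 hT'.1
  have e3 := union_inter_right (M := M) (mem_rkSets_restrict.1 hS).1 hT.1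
  have e4 := union_inter_right (M := M) (mem_rkSets_restrict.1 hS').1 hT'.1
  rw [h] at e1 e3
  exact Prod.ext (e1.symm.trans e2) (e3.symm.trans e4)

/-- **THE `U`-ROW OF THE MAXIMAL FLAT**: a `U`-set meets `E ∖ F` in at most one point, so
`#uSets k ≤ #fSets F k q + (p − q + 1)·#fSets F (k − 1) (q − 1)`. -/
theorem ncard_uSets_le_fSets (k : ℕ) (hk : 1 ≤ k) (hq : 1 ≤ q) :
    (uSets M p q k).ncard ≤ (S1.rkSets (M ↾ F) k q).ncard + (S1.rkSets (M ↾ F) (k - 1) (q - 1)).ncard * (p - q + 1) := by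
  have hXfin : (M.E \ F).Finite := M.ground_finite.subset sdiff_subset
  have hsub : uSets M p q k ⊆ S1.rkSets (M ↾ F) k q ∪
      (fun P : Set α × Set α => P.1 ∪ P.2) '' (S1.rkSets (M ↾ F) (k - 1) (q - 1) ×ˢ {T : Set α | T ⊆ M.E \ F ∧ T.ncard = 1}) := by
    rintro B ⟨hBE, hBk, hBq, hBp⟩
    have hBfin : B.Finite := M.ground_finite.subset hBE
    -- the complement of `B` spans, so `B` meets `X = E ∖ F` in at most one point
    have hcover : M.E \ B ⊆ F ∪ ((M.E \ F) \ B) := by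
      intro z hz
      by_cases hzF : z ∈ F
      · exact Or.inl hzF
      · exact Or.inr ⟨⟨hz.1, hzF⟩, hz.2⟩
    have h1 : M.eRk (M.E \ B) ≤ M.eRk F + ((M.E \ F) \ B).encard :=
      (M.eRk_mono hcover).trans (M.eRk_union_le_eRk_add_encard _ _)
    rw [hBp, hFr, ← (hXfin.subset sdiff_subset).cast_ncard_eq] at h1
    have h1' : p ≤ q + ((M.E \ F) \ B).ncard := by exact_mod_cast h1
    have h2 := ncard_sdiff_add_ncard_of_subset (inter_subset_left : (M.E \ F) ∩ B ⊆ M.E \ F) hXfin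
    have h3 : (M.E \ F) \ ((M.E \ F) ∩ B) = (M.E \ F) \ B := by
      ext z; simp only [Set.mem_sdiff, Set.mem_inter_iff]; tauto
    rw [h3, ncard_compl_eq hF hFn] at h2
    have hBX : ((M.E \ F) ∩ B).ncard ≤ 1 := by omega
    have hBdec : B = (B ∩ F) ∪ ((M.E \ F) ∩ B) := by
      ext z
      simp only [Set.mem_union, Set.mem_inter_iff, Set.mem_sdiff]
      constructor
      · intro hz
        by_cases hzF : z ∈ F
        · exact Or.inl ⟨hz, hzF⟩
        · exact Or.inr ⟨⟨hBE hz, hzF⟩, hz⟩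
      · rintro (⟨hz, -⟩ | ⟨-, hz⟩) <;> exact hz
    rcases Nat.le_one_iff_eq_zero_or_eq_one.1 hBX with h0 | h01
    · -- `B ⊆ F`
      left
      have hemp : (M.E \ F) ∩ B = ∅ := (ncard_eq_zero (hXfin.subset inter_subset_left)).1 h0
      have hBF : B ⊆ F := by
        intro z hz
        by_contra hzF
        have : z ∈ (M.E \ F) ∩ B := ⟨⟨hBE hz, hzF⟩, hz⟩
        rw [hemp] at this
        exact this
      exact mem_rkSets_restrict.2 ⟨hBF, hBk, hBq⟩
    · -- `B = S ∪ T` with `|T| = 1`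
      right
      set S := B ∩ F with hSdef
      set T := (M.E \ F) ∩ B with hTdef
      have hSF : S ⊆ F := inter_subset_right
      have hTX : T ⊆ M.E \ F := inter_subset_left
      have hTne : T ≠ M.E \ F := by
        intro h; rw [h, ncard_compl_eq hF hFn] at h01; omega
      have hdisj : Disjoint S T := Set.disjoint_left.2 (fun x hxS hxT => (hTX hxT).2 (hSF hxS))
      have hSk : S.ncard = k - 1 := by
        have := ncard_union_eq hdisj (hBfin.subset inter_subset_left) (hXfin.subset hTX)
        rw [← hBdec, hBk, h01] at this
        omega
      have hSfin : M.eRk S ≠ ⊤ := ne_top_of_le_ne_top (ENat.coe_ne_top q) (by rw [← hBq]; exact M.eRk_mono inter_subset_left)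
      obtain ⟨a, ha⟩ := ENat.ne_top_iff_exists.mp hSfin
      have hrk := eRk_union_eq_add hM hcol hF hFr hqp hFn hSF hTX hTne ha.symm
      rw [← hBdec, hBq, h01] at hrk
      have hrk' : q = a + 1 := by exact_mod_cast hrk
      refine ⟨⟨S, T⟩, ⟨mem_rkSets_restrict.2 ⟨hSF, hSk, ?_⟩, hTX, h01⟩, hBdec.symm⟩
      rw [← ha]; congr 1; omega
  calc (uSets M p q k).ncard ≤ _ :=
        ncard_le_ncard hsub ((fSets_finite hF k q).union
          ((S1.rkSets_finite k q).subset (glue_subset_rkSets hM hcol hF hFr hqp hFn k q 1 hk hq (by omega))))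
    _ ≤ _ := ncard_union_le _ _
    _ = _ := by rw [ncard_glue hF hFn, Nat.choose_one_right]

/-- **THE `Y`-ROW WITH THREE GLUES**: `Σ_{j=1}^{3} C(p−q+1, j)·#fSets F (k − j) (r − j) ≤ m[k, r]` for `3 ≤ k, r`, `3 < p − q + 1`. -/
theorem three_glue_le_rkSets (k r : ℕ) (h3k : 3 ≤ k) (h3r : 3 ≤ r) (h3c : 3 < p - q + 1) :
    (S1.rkSets (M ↾ F) (k - 1) (r - 1)).ncard * Nat.choose (p - q + 1) 1 +
      (S1.rkSets (M ↾ F) (k - 2) (r - 2)).ncard * Nat.choose (p - q + 1) 2 +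
      (S1.rkSets (M ↾ F) (k - 3) (r - 3)).ncard * Nat.choose (p - q + 1) 3 ≤ (S1.rkSets M k r).ncard := by
  set G : ℕ → Set (Set α) := fun j =>
    (fun P : Set α × Set α => P.1 ∪ P.2) '' (S1.rkSets (M ↾ F) (k - j) (r - j) ×ˢ {T : Set α | T ⊆ M.E \ F ∧ T.ncard = j}) with hG
  have hsubj : ∀ j, j ≤ k → j ≤ r → j < p - q + 1 → G j ⊆ S1.rkSets M k r := fun j h1 h2 h3 =>
    glue_subset_rkSets hM hcol hF hFr hqp hFn k r j h1 h2 h3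
  have hfin : ∀ j, j ≤ k → j ≤ r → j < p - q + 1 → (G j).Finite := fun j h1 h2 h3 =>
    (S1.rkSets_finite k r).subset (hsubj j h1 h2 h3)
  have hcard : ∀ j, (G j).ncard = (S1.rkSets (M ↾ F) (k - j) (r - j)).ncard * Nat.choose (p - q + 1) j := fun j =>
    ncard_glue hF hFn k r j
  have h12 : Disjoint (G 1) (G 2) := glue_disjoint k r (by decide)
  have h13 : Disjoint (G 1) (G 3) := glue_disjoint k r (by decide)
  have h23 : Disjoint (G 2) (G 3) := glue_disjoint k r (by decide)
  have hsub : G 1 ∪ G 2 ∪ G 3 ⊆ S1.rkSets M k r :=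
    union_subset (union_subset (hsubj 1 (by omega) (by omega) (by omega)) (hsubj 2 (by omega) (by omega) (by omega)))
      (hsubj 3 (by omega) (by omega) (by omega))
  have heq : (G 1 ∪ G 2 ∪ G 3).ncard = (G 1).ncard + (G 2).ncard + (G 3).ncard := by
    rw [ncard_union_eq (h13.union_left h23) ((hfin 1 (by omega) (by omega) (by omega)).union (hfin 2 (by omega) (by omega) (by omega)))
      (hfin 3 (by omega) (by omega) (by omega)), ncard_union_eq h12 (hfin 1 (by omega) (by omega) (by omega)) (hfin 2 (by omega) (by omega) (by omega))]
  rw [← hcard 1, ← hcard 2, ← hcard 3, ← heq]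
  exact ncard_le_ncard hsub (S1.rkSets_finite k r)

/-- **THE `Y`-ROW WITH TWO GLUES**: `C(p−q+1, 2)·#fSets F (k − 2) (r − 2) + C(p−q+1, 3)·#fSets F (k − 3) (r − 3) ≤ m[k, r]`. -/
theorem two_glue_le_rkSets (k r : ℕ) (h3k : 3 ≤ k) (h3r : 3 ≤ r) (h3c : 3 < p - q + 1) :
    (S1.rkSets (M ↾ F) (k - 2) (r - 2)).ncard * Nat.choose (p - q + 1) 2 +
      (S1.rkSets (M ↾ F) (k - 3) (r - 3)).ncard * Nat.choose (p - q + 1) 3 ≤ (S1.rkSets M k r).ncard := by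
  set G : ℕ → Set (Set α) := fun j =>
    (fun P : Set α × Set α => P.1 ∪ P.2) '' (S1.rkSets (M ↾ F) (k - j) (r - j) ×ˢ {T : Set α | T ⊆ M.E \ F ∧ T.ncard = j}) with hG
  have hsubj : ∀ j, j ≤ k → j ≤ r → j < p - q + 1 → G j ⊆ S1.rkSets M k r := fun j h1 h2 h3 =>
    glue_subset_rkSets hM hcol hF hFr hqp hFn k r j h1 h2 h3
  have hfin : ∀ j, j ≤ k → j ≤ r → j < p - q + 1 → (G j).Finite := fun j h1 h2 h3 =>
    (S1.rkSets_finite k r).subset (hsubj j h1 h2 h3)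
  have hcard : ∀ j, (G j).ncard = (S1.rkSets (M ↾ F) (k - j) (r - j)).ncard * Nat.choose (p - q + 1) j := fun j =>
    ncard_glue hF hFn k r j
  have h23 : Disjoint (G 2) (G 3) := glue_disjoint k r (by decide)
  have hsub : G 2 ∪ G 3 ⊆ S1.rkSets M k r :=
    union_subset (hsubj 2 (by omega) (by omega) (by omega)) (hsubj 3 (by omega) (by omega) (by omega))
  rw [← hcard 2, ← hcard 3, ← ncard_union_eq h23 (hfin 2 (by omega) (by omega) (by omega)) (hfin 3 (by omega) (by omega) (by omega))]
  exact ncard_le_ncard hsub (S1.rkSets_finite k r)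

end MaxFlat


/-- **The partition row of `F` as a `range`-sum, upper bound**: `Σ_{2 ≤ r ≤ q} #rkSets (M ↾ F) k r ≤ C(|F|, k)`. -/
theorem fp_le {F : Set α} (hF : F ⊆ M.E) {nF : ℕ} (hFn : F.ncard = nF) (q k C : ℕ) (hC : Nat.choose nF k = C) :
    ∑ i ∈ Finset.range (q + 1 - 2), (S1.rkSets (M ↾ F) k (2 + i)).ncard ≤ C := by
  have h := sum_ncard_fSets_le_choose hF k (Finset.Icc 2 q)
  rw [sum_Icc_eq_sum_range, hFn, hC] at h
  exact h

/-- **The partition row of `F` as a `range`-sum, lower bound**: `C(|F|, k) ≤ Σ_{2 ≤ r ≤ q} #rkSets (M ↾ F) k r` for `k ≥ 2`. -/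
theorem fp_ge (hpairs : ∀ e ∈ M.E, ∀ f ∈ M.E, e ≠ f → M.eRk {e, f} = 2) {F : Set α} (hF : F ⊆ M.E) {q : ℕ}
    (hFr : M.eRk F = (q : ℕ∞)) {nF : ℕ} (hFn : F.ncard = nF) (k C : ℕ) (hk : 2 ≤ k) (hC : Nat.choose nF k = C) :
    C ≤ ∑ i ∈ Finset.range (q + 1 - 2), (S1.rkSets (M ↾ F) k (2 + i)).ncard := by
  have h := choose_le_sum_ncard_fSets hpairs hF hFr hk
  rw [sum_Icc_eq_sum_range, hFn, hC] at h
  exact h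

/-- No `k`-subset of `F` for `k > |F|`. -/
theorem ncard_fSets_eq_zero_of_lt {F : Set α} (hF : F ⊆ M.E) {nF : ℕ} (hFn : F.ncard = nF) (k r : ℕ) (hk : nF < k) :
    (S1.rkSets (M ↾ F) k r).ncard = 0 := by
  rw [ncard_eq_zero (fSets_finite hF k r)]
  ext S
  simp only [Set.mem_empty_iff_false, iff_false]
  intro hS
  obtain ⟨h1, h2, -⟩ := mem_rkSets_restrict.1 hS
  have := ncard_le_ncard h1 (M.ground_finite.subset hF)
  omega

end S3MF

end PercRepro
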